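import Summits.KontsevichZagierPeriods.KontsevichZagierPeriods.Theorems.RootDecompQuadraticDescentKMahlerPairP1

/-! # `RootDecompQuadraticDescentKMahlerPairP2` — part 2/2 of the mechanical ≤400-line split of `KMahlerPair.lean` (sha256 6cb18bbec4b26f58…)
Source: decomp-kz lens-6 g12 KMahlerPair.lean @6cb18bbe (critic CLEARED g6-5 l.1307); --supports stmt-KontsevichZagierPeriods-28994.
Split by census-1 g10 `gen/splitlean.py`: scopes re-opened with their `open`/`variable`/`set_option` context; mathematics and declaration order unchanged. -/

noncomputable section
open MeasureTheory Set MvPolynomial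
open Literature.NumberTheory.Transcendental
open Literature.ModelTheory.ExponentialFields (IsSemialgebraic isSemialgebraic_setOf_eval_lt
  isSemialgebraic_setOf_eval_pos)
namespace Summit.KontsevichZagierPeriods.RootDecompQuadraticDescent.BandMerge
open Summit.KontsevichZagierPeriods.RootDecompQuadraticDescent.KMahler

/-- **The scaling move.** A representation with integrand `c/(u(1+τ²))` on `σ ⊆ {u > 0}` is KZ-equivalent (ONE
instance of rule (2), `Φ(τ,u) = (τ, L u)`, Jacobian `L`) to a representation with the SAME integrand on `Φ '' σ`.
(cite KontsevichZagier2001, §1.2 rule (2)) -/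
theorem scaleMove (c : ℚ) (L : ℕ) (hL : 0 < L) (r : KZ.IntegralRep 2)
    (hri : EqOn r.integrand (hC c) r.domain) (hpos : ∀ w ∈ r.domain, 0 < w 1) :
    ∃ r' : KZ.IntegralRep 2,
      r'.domain = (fun w : Fin 2 → ℝ => (![w 0, (L : ℝ) * w 1] : Fin 2 → ℝ)) '' r.domain ∧
      EqOn r'.integrand (hC c) r'.domain ∧ (∀ w ∈ r'.domain, 0 < w 1) ∧
      KZ.of r - KZ.of r' ∈ KZ.relations := by
  obtain ⟨Φ, hΦ⟩ : ∃ Φ : (Fin 2 → ℝ) → (Fin 2 → ℝ), ∀ w, Φ w = ![w 0, (L : ℝ) * w 1] :=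
    ⟨_, fun _ => rfl⟩
  have hLr : (0 : ℝ) < L := by exact_mod_cast hL
  have hΦeq : (fun w : Fin 2 → ℝ => (![w 0, (L : ℝ) * w 1] : Fin 2 → ℝ)) = Φ := by
    funext w
    exact (hΦ w).symm
  rw [hΦeq]
  have hΦsa : IsSemialgebraicMapOn ℚ r.domain Φ := scale_isSemialgebraicMapOn L Φ hΦ r.isSemialgebraic_domain
  have hinj : InjOn Φ r.domain := scale_injOn hLr.ne' Φ hΦ _
  choose Φ' hΦ' using scale_hasFDerivAt_det Φ hΦ
  have hderiv : ∀ x ∈ r.domain, HasFDerivWithinAt Φ (Φ' x) r.domain x :=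
    fun x _ => (hΦ' x).1.hasFDerivWithinAt
  have hjac : ∀ x ∈ r.domain, r.integrand x = hC c (Φ x) * |(Φ' x).det| := by
    intro x hx
    rw [hri hx, (hΦ' x).2, abs_of_pos hLr, hC, hC, (scale_apply Φ hΦ x).1, (scale_apply Φ hΦ x).2]
    have hu : x 1 ≠ 0 := (hpos x hx).ne'
    have ht : (1 + x 0 ^ 2) ≠ 0 := by positivity
    field_simp
  have hmeas : MeasurableSet r.domain := KZ.IntegralRep.measurableSet_domain_holds r
  have hT : IsSemialgebraic ℚ (Φ '' r.domain) :=
    IsSemialgebraicMapOn.isSemialgebraic_image_holds hΦsa subset_rfl r.isSemialgebraic_domain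
  have hpos' : ∀ w ∈ Φ '' r.domain, 0 < w 1 := by
    rintro _ ⟨x, hx, rfl⟩
    rw [(scale_apply Φ hΦ x).2]
    exact mul_pos hLr (hpos x hx)
  have hF := hC_isSemialgebraicFunOn c hT hpos'
  have hI : IntegrableOn (hC c) (Φ '' r.domain) := by
    rw [integrableOn_image_iff_integrableOn_abs_det_fderiv_smul volume hmeas hderiv hinj]
    refine r.integrableOn.congr_fun (fun x hx => ?_) hmeas
    rw [hjac x hx, smul_eq_mul, mul_comm]
  refine ⟨⟨Φ '' r.domain, hC c, hT, hF, hI⟩, rfl, fun _ _ => rfl, hpos', ?_⟩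
  exact KZ.changeOfVariablesRel_subset_relations
    ⟨2, r, _, Φ, Φ', hΦsa, hderiv, hinj, rfl, fun x hx => hjac x hx, rfl⟩

/-- The scaled copy of a band of height `M` lies in the band `L < u < L·M`. [folklore] -/
theorem scale_image_band {L M : ℕ} {σ : Set (Fin 2 → ℝ)} (hσ : σ ⊆ {w | 1 < w 1 ∧ w 1 < M})
    {w : Fin 2 → ℝ}
    (hw : w ∈ (fun w : Fin 2 → ℝ => (![w 0, (L : ℝ) * w 1] : Fin 2 → ℝ)) '' σ) (hL : 0 < L) :
    (L : ℝ) < w 1 ∧ w 1 < (L : ℝ) * M := by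
  obtain ⟨x, hx, rfl⟩ := hw
  have hLr : (0 : ℝ) < L := by exact_mod_cast hL
  obtain ⟨h1, h2⟩ := hσ hx
  simp only [Matrix.cons_val_one, Matrix.cons_val_fin_one]
  constructor <;> nlinarith

/-! ## The gluing move -/

/-- **Gluing.** Two representations with the common integrand `c/(u(1+τ²))` on DISJOINT domains inside `{u > 0}`
are jointly KZ-equivalent (ONE instance of rule (1a)) to the representation on the union.
(cite KontsevichZagier2001, §1.2 rule (1)) -/
theorem glueMove (c : ℚ) (r₁ r₂ : KZ.IntegralRep 2) (h₁ : EqOn r₁.integrand (hC c) r₁.domain)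
    (h₂ : EqOn r₂.integrand (hC c) r₂.domain) (hp₁ : ∀ w ∈ r₁.domain, 0 < w 1)
    (hp₂ : ∀ w ∈ r₂.domain, 0 < w 1) (hd : Disjoint r₁.domain r₂.domain) :
    ∃ G : KZ.IntegralRep 2, G.domain = r₁.domain ∪ r₂.domain ∧ EqOn G.integrand (hC c) G.domain ∧
      KZ.of G - KZ.of r₁ - KZ.of r₂ ∈ KZ.relations := by
  have hm₁ : MeasurableSet r₁.domain := KZ.IntegralRep.measurableSet_domain_holds r₁
  have hm₂ : MeasurableSet r₂.domain := KZ.IntegralRep.measurableSet_domain_holds r₂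
  have hσ : IsSemialgebraic ℚ (r₁.domain ∪ r₂.domain) :=
    r₁.isSemialgebraic_domain.union r₂.isSemialgebraic_domain
  have hpos : ∀ w ∈ r₁.domain ∪ r₂.domain, 0 < w 1 := by
    rintro w (hw | hw)
    exacts [hp₁ w hw, hp₂ w hw]
  have hI₁ : IntegrableOn (hC c) r₁.domain := r₁.integrableOn.congr_fun h₁ hm₁
  have hI₂ : IntegrableOn (hC c) r₂.domain := r₂.integrableOn.congr_fun h₂ hm₂
  refine ⟨⟨r₁.domain ∪ r₂.domain, hC c, hσ, hC_isSemialgebraicFunOn c hσ hpos, hI₁.union hI₂⟩, rfl,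
    fun _ _ => rfl, ?_⟩
  refine KZ.domainAddRel_subset_relations ⟨2, _, r₁, r₂, rfl, ?_, fun x hx => (h₁ hx).symm,
    fun x hx => (h₂ hx).symm, rfl⟩
  rw [Set.disjoint_iff_inter_eq_empty.mp hd]
  exact measure_empty

/-! ## The empty representation and the band class -/

/-- The representation with EMPTY domain (and integrand `c/(u(1+τ²))`). [folklore] -/
def emptyRep (c : ℚ) : KZ.IntegralRep 2 where
  domain := ∅
  integrand := hC c
  isSemialgebraic_domain := Literature.ModelTheory.ExponentialFields.isSemialgebraic_empty
  isSemialgebraicFunOn_integrand :=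
    hC_isSemialgebraicFunOn c Literature.ModelTheory.ExponentialFields.isSemialgebraic_empty
      fun _ h => (Set.notMem_empty _ h).elim
  integrableOn := integrableOn_empty

/-- `[emptyRep] ∈ KZ.relations` (rule (1a) with `∅ = ∅ ∪ ∅`, a null overlap). [folklore] -/
theorem of_emptyRep_mem (c : ℚ) : KZ.of (emptyRep c) ∈ KZ.relations := by
  have h : KZ.of (emptyRep c) - KZ.of (emptyRep c) - KZ.of (emptyRep c) ∈ KZ.relations := by
    refine KZ.domainAddRel_subset_relations ⟨2, emptyRep c, emptyRep c, emptyRep c, ?_, ?_,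
      fun _ _ => rfl, fun _ _ => rfl, rfl⟩
    · show (∅ : Set (Fin 2 → ℝ)) = ∅ ∪ ∅
      simp
    · show volume ((∅ : Set (Fin 2 → ℝ)) ∩ ∅) = 0
      simp
  have e : KZ.of (emptyRep c) - KZ.of (emptyRep c) - KZ.of (emptyRep c) = -KZ.of (emptyRep c) := by abel
  rw [e] at h
  simpa using KZ.relations.neg_mem h

/-- Auxiliary step `isBand_emptyRep`: is Band empty Rep. [bookkeeping] -/
theorem isBand_emptyRep (c : ℚ) : IsBand c 2 (emptyRep c) :=
  ⟨fun _ h => (Set.notMem_empty _ h).elim, Set.empty_subset _⟩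

/-- Stacking: a band representation `r₂` can be moved (one scaling) strictly above height `M₁` and glued (one
additivity) to a band representation `r₁` of height `M₁`; the result is a band representation of height
`(M₁+1)(M₂+1)` congruent to `[r₁] + [r₂]`. (cite KontsevichZagier2001, §1.2) -/
theorem stack {c : ℚ} {M₁ M₂ : ℕ} (r₁ r₂ : KZ.IntegralRep 2) (h₁ : IsBand c M₁ r₁) (h₂ : IsBand c M₂ r₂) :
    ∃ G : KZ.IntegralRep 2, IsBand c ((M₁ + 1) * (M₂ + 1)) G ∧
      KZ.of r₁ + KZ.of r₂ - KZ.of G ∈ KZ.relations := by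
  obtain ⟨s, hs, hsi, hsp, hrs⟩ := scaleMove c (M₁ + 1) (Nat.succ_pos _) r₂ h₂.1 h₂.pos
  have hsband : ∀ w ∈ s.domain, ((M₁ + 1 : ℕ) : ℝ) < w 1 ∧ w 1 < ((M₁ + 1 : ℕ) : ℝ) * M₂ :=
    fun w hw => scale_image_band h₂.2 (hs ▸ hw) (Nat.succ_pos _)
  have hd : Disjoint r₁.domain s.domain := by
    refine Set.disjoint_left.mpr fun w hw₁ hw₂ => ?_
    have a := (h₁.2 hw₁).2
    have b := (hsband w hw₂).1
    push_cast at b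
    linarith
  obtain ⟨G, hG, hGi, hrel⟩ := glueMove c r₁ s h₁.1 hsi h₁.pos hsp hd
  refine ⟨G, ⟨hGi, ?_⟩, ?_⟩
  · rw [hG]
    rintro w (hw | hw)
    · obtain ⟨a, b⟩ := h₁.2 hw
      refine ⟨a, b.trans_le ?_⟩
      have : (M₁ : ℝ) ≤ ((M₁ + 1) * (M₂ + 1) : ℕ) := by
        push_cast
        nlinarith [(Nat.cast_nonneg M₁ : (0:ℝ) ≤ M₁), (Nat.cast_nonneg M₂ : (0:ℝ) ≤ M₂)]
      exact this
    · obtain ⟨a, b⟩ := hsband w hw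
      push_cast at a b ⊢
      constructor
      · have : (0 : ℝ) ≤ M₁ := Nat.cast_nonneg M₁
        linarith
      · have : (0 : ℝ) ≤ M₁ := Nat.cast_nonneg M₁
        have : (0 : ℝ) ≤ M₂ := Nat.cast_nonneg M₂
        nlinarith
  · have e : KZ.of r₁ + KZ.of r₂ - KZ.of G = (KZ.of r₂ - KZ.of s) - (KZ.of G - KZ.of r₁ - KZ.of s) := by
      abel
    rw [e]
    exact sub_mem hrs hrel

/-- **The band class**: formal combinations congruent modulo `KZ.relations` to a difference `[r] − [r′]` of two
band representations (common `c`) form an additive subgroup of `FormalRep`. (cite KontsevichZagier2001, §1.2) -/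
def band (c : ℚ) : AddSubgroup KZ.FormalRep where
  carrier := {x | ∃ (M M' : ℕ) (r r' : KZ.IntegralRep 2), IsBand c M r ∧ IsBand c M' r' ∧
    x - (KZ.of r - KZ.of r') ∈ KZ.relations}
  zero_mem' := ⟨2, 2, emptyRep c, emptyRep c, isBand_emptyRep c, isBand_emptyRep c, by simp⟩
  add_mem' := by
    rintro x y ⟨M₁, M₁', r₁, r₁', h₁, h₁', hx⟩ ⟨M₂, M₂', r₂, r₂', h₂, h₂', hy⟩
    obtain ⟨G, hG, hGr⟩ := stack r₁ r₂ h₁ h₂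
    obtain ⟨G', hG', hGr'⟩ := stack r₁' r₂' h₁' h₂'
    refine ⟨_, _, G, G', hG, hG', ?_⟩
    have e : x + y - (KZ.of G - KZ.of G') = (x - (KZ.of r₁ - KZ.of r₁')) + (y - (KZ.of r₂ - KZ.of r₂')) +
        (KZ.of r₁ + KZ.of r₂ - KZ.of G) - (KZ.of r₁' + KZ.of r₂' - KZ.of G') := by abel
    rw [e]
    exact sub_mem (add_mem (add_mem hx hy) hGr) hGr'
  neg_mem' := by
    rintro x ⟨M, M', r, r', h, h', hx⟩
    refine ⟨M', M, r', r, h', h, ?_⟩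
    have e : -x - (KZ.of r' - KZ.of r) = -(x - (KZ.of r - KZ.of r')) := by abel
    rw [e]
    exact KZ.relations.neg_mem hx

/-- A band representation lies in the band class. [folklore] -/
theorem of_mem_band {c : ℚ} {M : ℕ} {r : KZ.IntegralRep 2} (h : IsBand c M r) : KZ.of r ∈ band c := by
  refine ⟨M, 2, r, emptyRep c, h, isBand_emptyRep c, ?_⟩
  have e : KZ.of r - (KZ.of r - KZ.of (emptyRep c)) = KZ.of (emptyRep c) := by abel
  rw [e]
  exact of_emptyRep_mem c

/-- **Extraction.** Every element of the band class is congruent modulo `KZ.relations` to `[r] − [r′]` with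
`r`, `r′` ℚ-RATIONAL two-dimensional representations, and its evaluation is `value r − value r′`.
(cite KontsevichZagier2001, §1.2) -/
theorem exists_rational_pair_of_mem_band {c : ℚ} {x : KZ.FormalRep} (hx : x ∈ band c) :
    ∃ r r' : KZ.IntegralRep 2, r.IsRational ∧ r'.IsRational ∧
      x - (KZ.of r - KZ.of r') ∈ KZ.relations ∧ KZ.eval x = r.value - r'.value := by
  obtain ⟨M, M', r, r', h, h', hrel⟩ := hx
  refine ⟨r, r', h.isRational, h'.isRational, hrel, ?_⟩
  have h0 := KZ.relations_le_ker_eval_holds hrel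
  rw [AddMonoidHom.mem_ker, map_sub, map_sub, KZ.eval_of, KZ.eval_of] at h0
  linarith

/-! ## Application: the pair form of K-M16/5 -/

/-- `R_k` is a band representation with `c = 2` and height `k + 2`. (cite Boyd1998, §1) -/
theorem isBand_mahlerRep (k : ℕ) : IsBand 2 (k + 2) (mahlerRep k) := by
  refine ⟨fun w hw => ?_, fun w hw => ?_⟩
  · show aeval w pNum / aeval w qDen = hC 2 w
    rw [aeval_pNum, aeval_qDen, hC]
    push_cast
    ring
  · have h := mem_Ioo_of_mem_mahlerDom (k := k) hw
    refine ⟨h.1, ?_⟩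
    push_cast
    exact h.2

/-- **K-M16/5, PAIR FORM.** There are ℚ-rational two-dimensional representations `r`, `r′` with
`6•[R₁₆] − 11•[R₅] ≡ [r] − [r′]` modulo `KZ.relations` and `6·value(R₁₆) − 11·value(R₅) = value r − value r′`
(five scalings and five gluings on each side, then one more stacking). (cite KontsevichZagier2001, §1.2) -/
theorem km165_pair : ∃ r r' : KZ.IntegralRep 2, r.IsRational ∧ r'.IsRational ∧
    (6 : ℤ) • KZ.of (mahlerRep 16) - (11 : ℤ) • KZ.of (mahlerRep 5) - (KZ.of r - KZ.of r') ∈ KZ.relations ∧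
    6 * (mahlerRep 16).value - 11 * (mahlerRep 5).value = r.value - r'.value := by
  have hmem : (6 : ℤ) • KZ.of (mahlerRep 16) - (11 : ℤ) • KZ.of (mahlerRep 5) ∈ band 2 :=
    sub_mem (AddSubgroup.zsmul_mem _ (of_mem_band (isBand_mahlerRep 16)) 6)
      (AddSubgroup.zsmul_mem _ (of_mem_band (isBand_mahlerRep 5)) 11)
  obtain ⟨r, r', hr, hr', hrel, hval⟩ := exists_rational_pair_of_mem_band hmem
  refine ⟨r, r', hr, hr', hrel, ?_⟩
  rw [← hval, map_sub, map_zsmul, map_zsmul, KZ.eval_of, KZ.eval_of, zsmul_eq_mul, zsmul_eq_mul]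
  push_cast
  ring

/-- **K-M16/5 is literally an instance of the conclusion of `DescentTwoQ` / Conjecture 1**: for the rational pair
`(r, r′)` of `km165_pair`, `KM165 ↔ KZ.Equivalent r r′` and `KM165Values ↔ value r = value r′`.
(cite KontsevichZagier2001, §1.2) (cite Lalin2010, Thm 1) -/
theorem km165_iff_equivalent : ∃ r r' : KZ.IntegralRep 2, r.IsRational ∧ r'.IsRational ∧
    (KM165 ↔ KZ.Equivalent r r') ∧ (KM165Values ↔ r.value = r'.value) := by
  obtain ⟨r, r', hr, hr', hrel, hval⟩ := km165_pair
  refine ⟨r, r', hr, hr', ?_, ?_⟩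
  · unfold KM165 KZ.Equivalent
    constructor
    · intro h
      have e : KZ.of r - KZ.of r' = ((6 : ℤ) • KZ.of (mahlerRep 16) - (11 : ℤ) • KZ.of (mahlerRep 5)) -
          ((6 : ℤ) • KZ.of (mahlerRep 16) - (11 : ℤ) • KZ.of (mahlerRep 5) - (KZ.of r - KZ.of r')) := by abel
      rw [e]
      exact sub_mem h hrel
    · intro h
      have e : (6 : ℤ) • KZ.of (mahlerRep 16) - (11 : ℤ) • KZ.of (mahlerRep 5) =
          ((6 : ℤ) • KZ.of (mahlerRep 16) - (11 : ℤ) • KZ.of (mahlerRep 5) - (KZ.of r - KZ.of r')) +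
          (KZ.of r - KZ.of r') := by abel
      rw [e]
      exact add_mem hrel h
  · unfold KM165Values
    constructor
    · intro h
      linarith
    · intro h
      linarith

/-- Hence: the conclusion of the summit statement at the rational pair `(r, r′)` (dimensions `2, 2 ≤ 2`), plus the
external value identity, gives K-M16/5 — the pair is served VERBATIM to `DescentTwoQ`'s conclusion shape.
(cite KontsevichZagier2001, §1.2) -/
theorem km165_of_pair_conclusion
    (hS : ∀ ⦃n m : ℕ⦄, n ≤ 2 → m ≤ 2 → ∀ (r : KZ.IntegralRep n) (r' : KZ.IntegralRep m),
      r.IsRational → r'.IsRational → r.value = r'.value → KZ.Equivalent r r')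
    (hV : KM165Values) : KM165 := by
  obtain ⟨r, r', hr, hr', hiff, hviff⟩ := km165_iff_equivalent
  exact hiff.mpr (hS le_rfl le_rfl r r' hr hr' (hviff.mp hV))

end Summit.KontsevichZagierPeriods.RootDecompQuadraticDescent.BandMerge
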